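import Summits.RiemannHypothesis.RiemannHypothesis.Theorems.WeilFormatCEntryBasis
import HarnessLib

/-!
# Format C, entry theorem (L-C1) — II: the pole form of a trigonometric window (Yoshida 1992, (5.1))

Helper file of the rh-explicit Weil-positivity programme (`--supports stmt-RiemannHypothesis-0098`; seat
rh-explicit-weil-2), RH-free, no definitions, no named facts.  Continues `WeilFormatCEntryBasis.lean`.

For Yoshida's window basis `χ_n(x) = (2a)^{-1/2} e^{πinx/a}·1_{[-a,a]}(x)` (`Yoshida1992.chi`) we prove the two
polar integrals in closed form,

  `∫_ℝ χ_n(x) cosh(x/2) dx = (−1)^n · 2(e^{a/2} − e^{−a/2}) / ((2a)^{1/2}(1 + 4ω_n²))`   (real),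
  `∫_ℝ χ_n(x) sinh(x/2) dx = −(−1)^n · 4ω_n(e^{a/2} − e^{−a/2}) / ((2a)^{1/2}(1 + 4ω_n²)) · i`   (imaginary),

`ω_n = πn/a`, and deduce the pole form `P(u) = 2|∫ u cosh(t/2)|² − 2|∫ u sinh(t/2)|²`
(`Literature.NumberTheory.LFunctions.weilPoleForm`, `= ∫ (u ⋆ ũ)(x)(e^{x/2} + e^{−x/2}) dx`) of every trigonometric
window as the Hermitian form printed in Yoshida (5.1)/(5.15)/(5.16) (first term):

  `P(Σ c_n χ_n) = Σ_n Σ_m Re(conj c_n · c_m) · (−1)^{n+m} (4/a)(e^{a/2} − e^{−a/2})² (1 − 4ω_nω_m)/((1 + 4ω_n²)(1 + 4ω_m²))`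

(`4ω_nω_m = 4π²nm/a²`, `1 + 4ω_n² = 1 + (2πn/a)²` as printed, p. 297).  `weilPoleForm_sum_smul_chi`.

References: H. Yoshida, Adv. Stud. Pure Math. 21 (1992) 281–325, §5 (5.1) p. 297 [Yoshida1992HermitianForms].
-/

set_option linter.dupNamespace false

noncomputable section

open Complex Set MeasureTheory Finset
open scoped Real ComplexConjugate BigOperators

namespace Summit.RiemannHypothesis.RiemannHypothesis.Theorems.WeilFormatC

open Literature.NumberTheory.LFunctions Literature.NumberTheory.LFunctions.Yoshida1992

variable {a : ℝ}

/-! ## The two polar integrals -/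

/-- The algebra of the two polar denominators: `S/(iω + ½) − S/(iω − ½) = 4S/(1 + 4ω²)`. -/
theorem polar_denom_add (S ω : ℝ) :
    (S : ℂ) / ((ω : ℂ) * I + (1 / 2 : ℝ)) - (S : ℂ) / ((ω : ℂ) * I + (-(1 / 2) : ℝ)) =
      ((4 * S / (1 + 4 * ω ^ 2) : ℝ) : ℂ) := by
  have h1 : ((ω : ℂ) * I + (1 / 2 : ℝ)) ≠ 0 := by
    intro h; simpa using congrArg Complex.re h
  have h2 : ((ω : ℂ) * I + (-(1 / 2) : ℝ)) ≠ 0 := by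
    intro h; simpa using congrArg Complex.re h
  have h3 : (1 : ℂ) + 4 * (ω : ℂ) ^ 2 ≠ 0 := by
    exact_mod_cast (show (1 + 4 * ω ^ 2 : ℝ) ≠ 0 by positivity)
  set D : ℂ := ((1 : ℂ) + 4 * (ω : ℂ) ^ 2)⁻¹ with hD_def
  have hD : ((1 : ℂ) + 4 * (ω : ℂ) ^ 2) * D = 1 := mul_inv_cancel₀ h3
  rw [div_sub_div _ _ h1 h2, div_eq_iff (mul_ne_zero h1 h2),
    show ((4 * S / (1 + 4 * ω ^ 2) : ℝ) : ℂ) = 4 * (S : ℂ) * D by rw [hD_def]; push_cast; ring]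
  push_cast
  linear_combination (-4 * (S : ℂ) * D * (ω : ℂ) ^ 2) * Complex.I_sq + (S : ℂ) * hD

/-- The algebra of the two polar denominators: `S/(iω + ½) + S/(iω − ½) = −8Sωi/(1 + 4ω²)`. -/
theorem polar_denom_sub (S ω : ℝ) :
    (S : ℂ) / ((ω : ℂ) * I + (1 / 2 : ℝ)) + (S : ℂ) / ((ω : ℂ) * I + (-(1 / 2) : ℝ)) =
      ((-(8 * S * ω) / (1 + 4 * ω ^ 2) : ℝ) : ℂ) * I := by
  have h1 : ((ω : ℂ) * I + (1 / 2 : ℝ)) ≠ 0 := by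
    intro h; simpa using congrArg Complex.re h
  have h2 : ((ω : ℂ) * I + (-(1 / 2) : ℝ)) ≠ 0 := by
    intro h; simpa using congrArg Complex.re h
  have h3 : (1 : ℂ) + 4 * (ω : ℂ) ^ 2 ≠ 0 := by
    exact_mod_cast (show (1 + 4 * ω ^ 2 : ℝ) ≠ 0 by positivity)
  set D : ℂ := ((1 : ℂ) + 4 * (ω : ℂ) ^ 2)⁻¹ with hD_def
  have hD : ((1 : ℂ) + 4 * (ω : ℂ) ^ 2) * D = 1 := mul_inv_cancel₀ h3
  rw [div_add_div _ _ h1 h2, div_eq_iff (mul_ne_zero h1 h2),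
    show ((-(8 * S * ω) / (1 + 4 * ω ^ 2) : ℝ) : ℂ) * I = -(8 * (S : ℂ) * ω) * D * I by
      rw [hD_def]; push_cast; ring]
  push_cast
  linear_combination (8 * (S : ℂ) * (ω : ℂ) ^ 3 * D * I) * Complex.I_sq + (-2 * (S : ℂ) * (ω : ℂ) * I) * hD

/-- **Polar integral, even part**: `∫_ℝ χ_n(x) cosh(x/2) dx = (-1)^n · 2(e^{a/2} − e^{−a/2}) / ((2a)^{1/2}(1 + 4ω_n²))`
(a real number). -/
theorem integral_chi_mul_cosh (ha : 0 < a) (n : ℤ) :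
    ∫ x, chi a n x * (Real.cosh (x / 2) : ℂ) =
      (((-1 : ℝ) ^ n * (2 * (Real.exp (a / 2) - Real.exp (-(a / 2)))) /
        (Real.sqrt (2 * a) * (1 + 4 * (π * n / a) ^ 2)) : ℝ) : ℂ) := by
  have hpt : (fun x : ℝ ↦ chi a n x * (Real.cosh (x / 2) : ℂ)) =
      fun x ↦ (1 / 2 : ℂ) * (chi a n x * cexp ((1 / 2 : ℝ) * x) + chi a n x * cexp ((-(1 / 2) : ℝ) * x)) := by
    funext x
    rw [Complex.ofReal_cosh, Complex.cosh]
    push_cast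
    ring_nf
  rw [hpt, integral_const_mul, integral_add (integrable_chi_mul n (by fun_prop)) (integrable_chi_mul n (by fun_prop)),
    integral_chi_mul_cexp ha n (by norm_num : (1 / 2 : ℝ) ≠ 0),
    integral_chi_mul_cexp ha n (by norm_num : (-(1 / 2) : ℝ) ≠ 0)]
  have hS := polar_denom_add (Real.exp (a / 2) - Real.exp (-(a / 2))) (π * n / a)
  have e1 : (1 / 2 : ℝ) * a = a / 2 := by ring
  have e2 : (-(1 / 2) : ℝ) * a = -(a / 2) := by ring
  rw [e1, e2, neg_neg]
  rw [show ((Real.exp (-(a / 2)) : ℝ) : ℂ) - (Real.exp (a / 2) : ℂ) =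
      -(((Real.exp (a / 2) - Real.exp (-(a / 2)) : ℝ) : ℂ)) by push_cast; ring,
    show ((Real.exp (a / 2) : ℝ) : ℂ) - (Real.exp (-(a / 2)) : ℂ) =
      (((Real.exp (a / 2) - Real.exp (-(a / 2)) : ℝ) : ℂ)) by push_cast; ring]
  set S : ℝ := Real.exp (a / 2) - Real.exp (-(a / 2))
  set ω : ℝ := π * n / a
  have key : (1 / 2 : ℂ) * (((1 / Real.sqrt (2 * a) : ℝ) : ℂ) * ((-1) ^ n * (S : ℂ) / ((ω : ℂ) * I + (1 / 2 : ℝ))) +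
      ((1 / Real.sqrt (2 * a) : ℝ) : ℂ) * ((-1) ^ n * -(S : ℂ) / ((ω : ℂ) * I + (-(1 / 2) : ℝ)))) =
      (1 / 2 : ℂ) * ((1 / Real.sqrt (2 * a) : ℝ) : ℂ) * (-1) ^ n *
        ((S : ℂ) / ((ω : ℂ) * I + (1 / 2 : ℝ)) - (S : ℂ) / ((ω : ℂ) * I + (-(1 / 2) : ℝ))) := by ring
  rw [key, hS]
  push_cast
  field_simp
  ring

/-- **Polar integral, odd part**: `∫_ℝ χ_n(x) sinh(x/2) dx = −(-1)^n · 4ω_n(e^{a/2} − e^{−a/2}) / ((2a)^{1/2}(1 + 4ω_n²)) · i`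
(a purely imaginary number). -/
theorem integral_chi_mul_sinh (ha : 0 < a) (n : ℤ) :
    ∫ x, chi a n x * (Real.sinh (x / 2) : ℂ) =
      ((-((-1 : ℝ) ^ n * (4 * (π * n / a) * (Real.exp (a / 2) - Real.exp (-(a / 2))))) /
        (Real.sqrt (2 * a) * (1 + 4 * (π * n / a) ^ 2)) : ℝ) : ℂ) * I := by
  have hpt : (fun x : ℝ ↦ chi a n x * (Real.sinh (x / 2) : ℂ)) =
      fun x ↦ (1 / 2 : ℂ) * (chi a n x * cexp ((1 / 2 : ℝ) * x) - chi a n x * cexp ((-(1 / 2) : ℝ) * x)) := by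
    funext x
    rw [Complex.ofReal_sinh, Complex.sinh]
    push_cast
    ring_nf
  rw [hpt, integral_const_mul, integral_sub (integrable_chi_mul n (by fun_prop)) (integrable_chi_mul n (by fun_prop)),
    integral_chi_mul_cexp ha n (by norm_num : (1 / 2 : ℝ) ≠ 0),
    integral_chi_mul_cexp ha n (by norm_num : (-(1 / 2) : ℝ) ≠ 0)]
  have hS := polar_denom_sub (Real.exp (a / 2) - Real.exp (-(a / 2))) (π * n / a)
  have e1 : (1 / 2 : ℝ) * a = a / 2 := by ring
  have e2 : (-(1 / 2) : ℝ) * a = -(a / 2) := by ring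
  rw [e1, e2, neg_neg]
  rw [show ((Real.exp (-(a / 2)) : ℝ) : ℂ) - (Real.exp (a / 2) : ℂ) =
      -(((Real.exp (a / 2) - Real.exp (-(a / 2)) : ℝ) : ℂ)) by push_cast; ring,
    show ((Real.exp (a / 2) : ℝ) : ℂ) - (Real.exp (-(a / 2)) : ℂ) =
      (((Real.exp (a / 2) - Real.exp (-(a / 2)) : ℝ) : ℂ)) by push_cast; ring]
  set S : ℝ := Real.exp (a / 2) - Real.exp (-(a / 2))
  set ω : ℝ := π * n / a
  have key : (1 / 2 : ℂ) * (((1 / Real.sqrt (2 * a) : ℝ) : ℂ) * ((-1) ^ n * (S : ℂ) / ((ω : ℂ) * I + (1 / 2 : ℝ))) -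
      ((1 / Real.sqrt (2 * a) : ℝ) : ℂ) * ((-1) ^ n * -(S : ℂ) / ((ω : ℂ) * I + (-(1 / 2) : ℝ)))) =
      (1 / 2 : ℂ) * ((1 / Real.sqrt (2 * a) : ℝ) : ℂ) * (-1) ^ n *
        ((S : ℂ) / ((ω : ℂ) * I + (1 / 2 : ℝ)) + (S : ℂ) / ((ω : ℂ) * I + (-(1 / 2) : ℝ))) := by ring
  rw [key, hS]
  push_cast
  field_simp
  ring

/-! ## The pole form (Yoshida (5.1)) -/

/-- **Pole form of a trigonometric window = Yoshida (5.1)**: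
`P(Σ c_n χ_n) = Σ_n Σ_m Re(conj c_n · c_m) · (−1)^{n+m} (4/a)(e^{a/2} − e^{−a/2})² (1 − 4ω_nω_m)/((1 + 4ω_n²)(1 + 4ω_m²))`,
`ω_n = πn/a` (so that `4ω_nω_m = 4π²nm/a²` and `1 + 4ω_n² = 1 + (2πn/a)²` as printed). -/
theorem weilPoleForm_sum_smul_chi (ha : 0 < a) (s : Finset ℤ) (c : ℤ → ℂ) :
    weilPoleForm (∑ n ∈ s, c n • chi a n) =
      ∑ n ∈ s, ∑ m ∈ s, (conj (c n) * c m).re *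
        ((-1 : ℝ) ^ (n + m) * (4 / a) * (Real.exp (a / 2) - Real.exp (-(a / 2))) ^ 2 *
          (1 - 4 * (π * n / a) * (π * m / a)) / ((1 + 4 * (π * n / a) ^ 2) * (1 + 4 * (π * m / a) ^ 2))) := by
  unfold weilPoleForm
  rw [integral_sum_smul_chi_mul s c (by fun_prop), integral_sum_smul_chi_mul s c (by fun_prop)]
  simp_rw [integral_chi_mul_cosh ha, integral_chi_mul_sinh ha]
  -- the `cosh` part is a combination of REAL numbers, the `sinh` part of purely imaginary ones
  rw [sum_mul_ofReal_mul_I, norm_mul, Complex.norm_I, mul_one, norm_sq_sum_mul_ofReal,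
    norm_sq_sum_mul_ofReal, Finset.mul_sum, Finset.mul_sum, ← Finset.sum_sub_distrib]
  refine Finset.sum_congr rfl fun n _ ↦ ?_
  rw [Finset.mul_sum, Finset.mul_sum, ← Finset.sum_sub_distrib]
  refine Finset.sum_congr rfl fun m _ ↦ ?_
  have hsq : a = Real.sqrt (2 * a) ^ 2 / 2 := by
    rw [Real.sq_sqrt (by positivity)]; ring
  have hq : 0 < Real.sqrt (2 * a) := Real.sqrt_pos.2 (by positivity)
  generalize Real.sqrt (2 * a) = q at hsq hq ⊢
  subst hsq
  have hq' : q ≠ 0 := hq.ne'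
  have hn' : (1 + 4 * (π * n / (q ^ 2 / 2)) ^ 2) ≠ 0 := by positivity
  have hm' : (1 + 4 * (π * m / (q ^ 2 / 2)) ^ 2) ≠ 0 := by positivity
  rw [zpow_add₀ (by norm_num : (-1 : ℝ) ≠ 0)]
  field_simp
  ring

end Summit.RiemannHypothesis.RiemannHypothesis.Theorems.WeilFormatC
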